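import Literature.Algebra.Homology.NatCochainSixTerm
import Literature.Algebra.Homology.NatCochainCokernelSequence
import HarnessLib

/-!
# Comparing a cokernel complex with a bigger complex through an injective cochain map onto in degree zero

C. A. Weibel, *An Introduction to Homological Algebra* (1994), §1.1–1.3, bookkeeping for
J.-P. Serre's dimension count over hyperplane sections (*FAC* (1955) n° 81; *GAGA* (1956) n° 16
Lemme 8) in the form used by the tree (`EulerInequalityGrowth`): when the restriction of sections
to a hyperplane section `0 → C•(L) →ᵗ C•(L(H)) →ʳ C•_H(L(H))` is exact on the left and in the middle
but onto only in degree `0` (onto on the MEMBERS of the cover, not on all finite intersections), the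
six-term inequality still holds with the numbers of the bigger complex `C•_H`:

* `NatCochain.finrank_cohomology_zero_eq_of_injective_of_surjective_zero`,
  `…injective_map_one_of_injective_of_surjective_zero` — an injective cochain map `φ : K → C` which
  is onto in degree `0` induces `H⁰(K) ≅ H⁰(C)` and `H¹(K) ↪ H¹(C)`;
* `NatCochain.ShortExactSeq.finrank_six_term_le_of_comparison` — for a short exact sequence
  `0 → A → B → K → 0` of complexes and such a `φ : K → C`, with `H⁰, H¹` of `A, B, C`
  finite-dimensional: `h⁰(A) + h⁰(C) + h¹(B) ≤ h⁰(B) + h¹(A) + h¹(C)`.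

Pure linear algebra; everything is proved.

## References

* C. A. Weibel, *An Introduction to Homological Algebra*, CUP (1994), §1.1, Thm. 1.3.1. [Weibel1994]
* J.-P. Serre, *Géométrie algébrique et géométrie analytique*, Ann. Inst. Fourier 6 (1956), n° 16
  Lemme 8. [SerreGAGA1956]
-/

namespace Literature.Algebra.Homology

universe u w w' w'' w'''

open Function Module

namespace NatCochain

variable {R : Type u} [CommRing R]
  {K : ℕ → Type w''} [∀ n, AddCommGroup (K n)] [∀ n, Module R (K n)]
  {C : ℕ → Type w'''} [∀ n, AddCommGroup (C n)] [∀ n, Module R (C n)]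
  {dK : ∀ n, K n →ₗ[R] K (n + 1)} {dC : ∀ n, C n →ₗ[R] C (n + 1)}
  (φ : ∀ n, K n →ₗ[R] C n) (hφ : ∀ n x, φ (n + 1) (dK n x) = dC n (φ n x))

/-! ### An injective cochain map onto in degree zero -/

/-- **`H⁰(φ)` is injective when `φ⁰` is** (there are no coboundaries in degree `0`). [cite: Weibel1994, Def. 1.1.1] -/
theorem injective_map_zero_of_injective (h0 : Injective (φ 0)) : Injective (Cohomology.map φ hφ 0) := by
  intro c c' hcc'
  obtain ⟨x, rfl⟩ := Cohomology.mk_surjective dK 0 c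
  obtain ⟨x', rfl⟩ := Cohomology.mk_surjective dK 0 c'
  rw [Cohomology.map_mk, Cohomology.map_mk, Cohomology.mk_eq_mk_iff, coboundaries_zero,
    Submodule.mem_bot, Cohomology.coe_mapCocycles, Cohomology.coe_mapCocycles, ← map_sub] at hcc'
  rw [Cohomology.mk_eq_mk_iff, coboundaries_zero, Submodule.mem_bot]
  exact h0 (by rw [hcc', map_zero])

/-- **`H⁰(φ)` is surjective when `φ⁰` is onto and `φ¹` is injective**: a cocycle `z = φ⁰ x` has
`φ¹ (d x) = d z = 0`, so `x` is a cocycle. [cite: Weibel1994, Def. 1.1.1] -/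
theorem surjective_map_zero_of_surjective (h0 : Surjective (φ 0)) (h1 : Injective (φ 1)) :
    Surjective (Cohomology.map φ hφ 0) := by
  intro c
  obtain ⟨z, rfl⟩ := Cohomology.mk_surjective dC 0 c
  obtain ⟨x, hx⟩ := h0 z
  have hxz : x ∈ cocycles dK 0 := by
    rw [mem_cocycles_iff]
    apply h1
    rw [hφ, hx, map_zero]
    exact (mem_cocycles_iff dC).1 z.2
  refine ⟨Cohomology.mk dK 0 ⟨x, hxz⟩, ?_⟩
  rw [Cohomology.map_mk]
  congr 1
  exact Subtype.ext hx

/-- **`H¹(φ)` is injective when `φ⁰` is onto and `φ¹` is injective**: if `φ¹ x = d c⁰` with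
`c⁰ = φ⁰ x⁰` then `φ¹ (x - d x⁰) = 0`. [cite: Weibel1994, Def. 1.1.1] -/
theorem injective_map_one_of_injective_of_surjective_zero (h0 : Surjective (φ 0)) (h1 : Injective (φ 1)) :
    Injective (Cohomology.map φ hφ 1) := by
  refine (injective_iff_map_eq_zero _).2 fun c hc ↦ ?_
  obtain ⟨x, rfl⟩ := Cohomology.mk_surjective dK 1 c
  rw [Cohomology.map_mk, Cohomology.mk_eq_zero_iff, Cohomology.coe_mapCocycles,
    mem_coboundaries_succ_iff] at hc
  obtain ⟨y, hy⟩ := hc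
  obtain ⟨x₀, rfl⟩ := h0 y
  rw [Cohomology.mk_eq_zero_iff, mem_coboundaries_succ_iff]
  refine ⟨x₀, h1 ?_⟩
  rw [hφ, hy]

/-- The `H⁰` comparison as a linear equivalence. [folklore] -/
noncomputable def cohomologyZeroEquiv (h0i : Injective (φ 0)) (h0s : Surjective (φ 0)) (h1 : Injective (φ 1)) :
    Cohomology dK 0 ≃ₗ[R] Cohomology dC 0 :=
  LinearEquiv.ofBijective (Cohomology.map φ hφ 0)
    ⟨injective_map_zero_of_injective φ hφ h0i, surjective_map_zero_of_surjective φ hφ h0s h1⟩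

end NatCochain

/-! ### The six-term inequality with a comparison complex -/

namespace NatCochain.ShortExactSeq

variable {F : Type u} [Field F]
  {A : ℕ → Type w} [∀ n, AddCommGroup (A n)] [∀ n, Module F (A n)]
  {B : ℕ → Type w'} [∀ n, AddCommGroup (B n)] [∀ n, Module F (B n)]
  {K : ℕ → Type w''} [∀ n, AddCommGroup (K n)] [∀ n, Module F (K n)]
  {C : ℕ → Type w'''} [∀ n, AddCommGroup (C n)] [∀ n, Module F (C n)]
  {dA : ∀ n, A n →ₗ[F] A (n + 1)} {dB : ∀ n, B n →ₗ[F] B (n + 1)}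
  {dK : ∀ n, K n →ₗ[F] K (n + 1)} {dC : ∀ n, C n →ₗ[F] C (n + 1)}

/-- **The six-term inequality through a comparison complex.** Let `0 → A → B → K → 0` be a short
exact sequence of complexes of vector spaces and `φ : K → C` a cochain map, injective in degrees `0`
and `1` and onto in degree `0`. If `H⁰, H¹` of `A`, `B` and `C` are finite-dimensional then
`h⁰(A) + h⁰(C) + h¹(B) ≤ h⁰(B) + h¹(A) + h¹(C)` (`finrank_six_term_le` for `(A, B, K)` with
`H⁰(K) ≅ H⁰(C)` and `H¹(K) ↪ H¹(C)`). This is the inequality of Serre's dimension count when the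
restriction to the hyperplane section is onto on the members of the cover only.
[cite: SerreGAGA1956, n° 16 Lemme 8 (dimension count)] -/
theorem finrank_six_term_le_of_comparison (S : ShortExactSeq dA dB dK) (φ : ∀ n, K n →ₗ[F] C n)
    (hφ : ∀ n x, φ (n + 1) (dK n x) = dC n (φ n x)) (h0i : Injective (φ 0)) (h0s : Surjective (φ 0))
    (h1 : Injective (φ 1))
    [FiniteDimensional F (Cohomology dB 0)] [FiniteDimensional F (Cohomology dC 0)]
    [FiniteDimensional F (Cohomology dA 1)] [FiniteDimensional F (Cohomology dB 1)]
    [FiniteDimensional F (Cohomology dC 1)] :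
    finrank F (Cohomology dA 0) + finrank F (Cohomology dC 0) + finrank F (Cohomology dB 1) ≤
      finrank F (Cohomology dB 0) + finrank F (Cohomology dA 1) + finrank F (Cohomology dC 1) := by
  set e := NatCochain.cohomologyZeroEquiv φ hφ h0i h0s h1 with he
  haveI : FiniteDimensional F (Cohomology dK 0) := Module.Finite.equiv e.symm
  have hinj := NatCochain.injective_map_one_of_injective_of_surjective_zero φ hφ h0s h1
  haveI : FiniteDimensional F (Cohomology dK 1) := Module.Finite.of_injective _ hinj
  have h6 := S.finrank_six_term_le
  have hK0 : finrank F (Cohomology dK 0) = finrank F (Cohomology dC 0) := e.finrank_eq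
  have hK1 : finrank F (Cohomology dK 1) ≤ finrank F (Cohomology dC 1) := LinearMap.finrank_le_finrank_of_injective hinj
  omega

end NatCochain.ShortExactSeq

end Literature.Algebra.Homology
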